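import Summits.BirchSwinnertonDyer.BirchSwinnertonDyer.Theorems.KatoDescentPotSupersingularExactFineControl
import HarnessLib

/-!
# EXACT FINE CONTROL on the ROWS of crux M: every additive `p ≥ 11` (all (t′) rows of K8-t′), and additive
# `p ∈ {5, 7}` off Kodaira II/III — `#Sel_str(ℚ, W[p^∞]) = #Sel₀(ℚ_∞, W[p^∞])^Γ = #(X₀)_Γ` and
# `KatoH2CountAt W p #(X₀)_Γ` with the local hypothesis `W(ℚ_p)[p] = 0` DISCHARGED (crux M 19196)

Seat `bsd-potss-rkm` g27 (prover, cell `bsd-potss`), `--supports stmt-BirchSwinnertonDyer-19196 --as helper`;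
route-free; closes nothing.  HONEST FRAMING: BSD is not proved by any of this; nothing is booked; crux M stays
cite-level on {modularity, 27962}; theorems only (no definition, no named fact, no `sorry`).

The sibling `KatoDescentPotSupersingularExactFineControl` proves, for `p` odd, `κ` cyclotomic with generator `γ`
and `W(ℚ_p)[p] = 0`: `Sel_str(ℚ, W[p^∞]) ≅ Sel₀(ℚ_∞, W[p^∞])^Γ`, `#(X₀/TX₀) = #Sel_str(ℚ, W[p^∞])` for every
dual fine Selmer datum, and `KatoH2CountAt W p #(X₀)_Γ` (clause (c2′) of the held core package 27962 for the
pinned `X₀ = 𝐇²_Γ`).  Here `W(ℚ_p)[p] = 0` is discharged on the rows of M by the tree's Mazur III.§5 lemmas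
(`Additive.eq_zero_of_prime_nsmul_eq_zero_of_addv_of_eleven_le`, `…_of_addv`; `W` globally minimal):

* `…_of_addv_of_eleven_le` — EVERY additive prime `p ≥ 11` (no side condition): all (t′) rows of K8-t′;
* `…_of_addv` — additive `p ≥ 5` with `p = 5 ⟹ v₅(c₄) ≠ 1`, `p = 7 ⟹ v₇(c₆) ≠ 1`.

References: K. Kato, Astérisque 295 (2004) (14.9.3) p. 240, (14.14.2) p. 243 [Kato2004Asterisque]; R. Greenberg,
LNM 1716 (1999) Prop. 3.8 [GreenbergLNM1716]; B. Mazur, Publ. IHÉS 47 (1977) III.§5 Step 1 (p. 158) [Mazur1977].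
-/

-- the summit and its single problem are both named `BirchSwinnertonDyer` (registry layout D-0017)
set_option linter.dupNamespace false
set_option autoImplicit false

noncomputable section

open scoped Classical NumberField
open Function Field NumberField IsDedekindDomain
open Literature.NumberTheory.EllipticCurves Literature.NumberTheory.EllipticCurves.GreenbergSelmer
  Literature.NumberTheory.EllipticCurves.ZpExtension Literature.NumberTheory.EllipticCurves.Kato2004
  Literature.NumberTheory.GaloisRepresentations
open Literature.NumberTheory.EllipticCurves.Rank1Residual Summit.BirchSwinnertonDyer.Rank1Residual
open Summit.BirchSwinnertonDyer.BirchSwinnertonDyer.Theorems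

namespace Summit.BirchSwinnertonDyer.BirchSwinnertonDyer.Theorems.ExactFineControl

variable (W : WeierstrassCurve ℚ) [W.IsElliptic] [W.IsGloballyMinimal] {p : ℕ} [hp : Fact p.Prime]
  (κ : ZpExtension ℚ p)

/-! ## §1 Every additive `p ≥ 11` -/

/-- **`#Sel_str(ℚ, W[p^∞]) = #Sel₀(ℚ_∞, W[p^∞])^Γ` at every ADDITIVE prime `p ≥ 11`** (`κ` cyclotomic, generator `γ`).
[cite: Kato2004Asterisque, (14.9.3) (p. 240)] [cite: GreenbergLNM1716, Prop. 3.8 (pp. 95–96)] [cite: Mazur1977, Ch. III §5, Step 1 (p. 158)] -/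
theorem natCard_katoStrictSelmer_eq_natCard_fineSelmerInfty_invariants_of_addv_of_eleven_le (h11 : 11 ≤ p)
    (hadd : Addv W p) (hκ : κ.IsCyclotomic) {γ : absoluteGaloisGroup ℚ} (hγ : κ.IsTopGenerator γ) :
    Nat.card (katoStrictSelmer W p {primePlace p}) =
      Nat.card (IwasawaDual.endInvariants (W.conjFineSelmerInfty κ γ - 1)) :=
  natCard_katoStrictSelmer_eq_natCard_fineSelmerInfty_invariants W κ (by omega) hκ hγ
    fun _ hR => Additive.eq_zero_of_prime_nsmul_eq_zero_of_addv_of_eleven_le W p h11 hadd hR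

/-- **`#(X₀)_Γ = #Sel_str(ℚ, W[p^∞])` at every additive `p ≥ 11`**, for every dual fine Selmer datum.
[cite: Kato2004Asterisque, (14.9.3) (p. 240) and (14.14.2) (p. 243)] [cite: Mazur1977, Ch. III §5, Step 1 (p. 158)] -/
theorem natCard_coinvariants_fineSelmerDual_eq_natCard_katoStrictSelmer_of_addv_of_eleven_le (h11 : 11 ≤ p)
    (hadd : Addv W p) (hκ : κ.IsCyclotomic) {γ : absoluteGaloisGroup ℚ} (hγ : κ.IsTopGenerator γ)
    (Y : W.FineSelmerDualData κ γ) :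
    Nat.card (IwasawaAlgebra.coinvariants p Y.X) = Nat.card (katoStrictSelmer W p {primePlace p}) :=
  natCard_coinvariants_fineSelmerDual_eq_natCard_katoStrictSelmer W κ (by omega) hκ hγ
    (fun _ hR => Additive.eq_zero_of_prime_nsmul_eq_zero_of_addv_of_eleven_le W p h11 hadd hR) Y

/-- **`KatoH2CountAt W p #(X₀)_Γ` at every additive `p ≥ 11`** — clause (c2′) of the held core package for the
pinned `X₀ = 𝐇²_Γ(T_pW)` on ALL (t′) rows of K8-t′, as a kernel theorem.
[cite: Kato2004Asterisque, (14.9.3) (p. 240) and (14.14.2) (p. 243)] [cite: Mazur1977, Ch. III §5, Step 1 (p. 158)] -/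
theorem katoH2CountAt_natCard_coinvariants_fineSelmerDual_of_addv_of_eleven_le (h11 : 11 ≤ p)
    (hadd : Addv W p) (hκ : κ.IsCyclotomic) {γ : absoluteGaloisGroup ℚ} (hγ : κ.IsTopGenerator γ)
    (Y : W.FineSelmerDualData κ γ) :
    KatoH2CountAt W p (Nat.card (IwasawaAlgebra.coinvariants p Y.X)) :=
  katoH2CountAt_natCard_coinvariants_fineSelmerDual W κ (by omega) hκ hγ
    (fun _ hR => Additive.eq_zero_of_prime_nsmul_eq_zero_of_addv_of_eleven_le W p h11 hadd hR) Y

/-! ## §2 Additive `p ≥ 5` off Kodaira II/III -/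

/-- **`#Sel_str(ℚ, W[p^∞]) = #Sel₀(ℚ_∞, W[p^∞])^Γ` at an additive `p ≥ 5` off the exceptional locus**
(`p = 5 ⟹ v₅(c₄) ≠ 1`, `p = 7 ⟹ v₇(c₆) ≠ 1`). [cite: Kato2004Asterisque, (14.9.3) (p. 240)] [cite: Mazur1977, Ch. III §5, Step 1 (p. 158)] -/
theorem natCard_katoStrictSelmer_eq_natCard_fineSelmerInfty_invariants_of_addv (hp5 : 5 ≤ p) (hadd : Addv W p)
    (h5 : p = 5 → padicValRat p W.c₄ ≠ 1) (h7 : p = 7 → padicValRat p W.c₆ ≠ 1)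
    (hκ : κ.IsCyclotomic) {γ : absoluteGaloisGroup ℚ} (hγ : κ.IsTopGenerator γ) :
    Nat.card (katoStrictSelmer W p {primePlace p}) =
      Nat.card (IwasawaDual.endInvariants (W.conjFineSelmerInfty κ γ - 1)) :=
  natCard_katoStrictSelmer_eq_natCard_fineSelmerInfty_invariants W κ (by omega) hκ hγ
    fun _ hR => Additive.eq_zero_of_prime_nsmul_eq_zero_of_addv W p hp5 hadd h5 h7 hR

/-- **`KatoH2CountAt W p #(X₀)_Γ` at an additive `p ≥ 5` off Kodaira II/III**, every dual fine Selmer datum.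
[cite: Kato2004Asterisque, (14.9.3) (p. 240) and (14.14.2) (p. 243)] [cite: Mazur1977, Ch. III §5, Step 1 (p. 158)] -/
theorem katoH2CountAt_natCard_coinvariants_fineSelmerDual_of_addv (hp5 : 5 ≤ p) (hadd : Addv W p)
    (h5 : p = 5 → padicValRat p W.c₄ ≠ 1) (h7 : p = 7 → padicValRat p W.c₆ ≠ 1)
    (hκ : κ.IsCyclotomic) {γ : absoluteGaloisGroup ℚ} (hγ : κ.IsTopGenerator γ) (Y : W.FineSelmerDualData κ γ) :
    KatoH2CountAt W p (Nat.card (IwasawaAlgebra.coinvariants p Y.X)) :=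
  katoH2CountAt_natCard_coinvariants_fineSelmerDual W κ (by omega) hκ hγ
    (fun _ hR => Additive.eq_zero_of_prime_nsmul_eq_zero_of_addv W p hp5 hadd h5 h7 hR) Y

end Summit.BirchSwinnertonDyer.BirchSwinnertonDyer.Theorems.ExactFineControl

end
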